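import Mathlib
import Summits.ValiantsHypothesis.ValiantsHypothesis.Theorems.LacunarySymmetroidMatrixDescartesCensusRealExponentsTwoByTwoKit

/-!
# `MatrixDescartes` census — eventual signs of a cubic at `0⁺` and the balanced four-member family

HONEST FRAMING.  Object-search cell `pub-symmetroid`, item `DoorA34 = PosRootLawAt 3 4 18`
(stmt-ValiantsHypothesis-19980; OPEN, typed, never asserted) and the cell's `(3,K,B)` rows; this file
contains only ELEMENTARY limit bookkeeping consumed by `…CensusRealExponentsThreeByThree`
(`posRootLawAt_three_iff_rpow`, report DOOR-A-P1-REPORT §29, SPEC A), where the member functions are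
`ε ↦ det(F(z) ± ε e^{δ₀ z} V)`, `V ∈ {1, 1 − κ·nnᵀ}`, expanded by `det_add_smul_fin_three`
(`…ThreeByThreeKit`).  Decides nothing; nothing here bears on `MatrixDescartes`
(stmt-ValiantsHypothesis-18050) or `VP ≠ VNP`.

* `cubic_eventually_sign`, `cubic_eventually_ne_zero` — as `ε → 0⁺` the sign of
  `(εE)a + (εE)²b + (εE)³c` (`E > 0`) is the sign of its first non-zero coefficient;
* `balance_four` — for the family indexed by `(V, s) ∈ Bool × Bool` with member functions
  `(εE)a_V + (εE)²b_V + (εE)³c_V` (`s = true`) and `−(εE)a_V + (εE)²b_V − (εE)³c_V` (`s = false`),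
  in each of the three cases «`a_1, a_W ≠ 0`» / «`a ≡ 0`, `b_1·b_W < 0`» / «`a ≡ b ≡ 0`,
  `c_1, c_W ≠ 0`» at least half of the four members are eventually negative and at least half
  eventually positive (the BALANCE hypothesis of `exists_signVar_of_zeros_family`).

[folklore] Limits of polynomials at `0⁺`; finite bookkeeping.
-/

-- `Summit.ValiantsHypothesis.ValiantsHypothesis.…` repeats a component by the D-0017 layout
-- (single-conjunct summit), which the `dupNamespace` linter flags; the name is mandated.
set_option linter.dupNamespace false

namespace Summit.ValiantsHypothesis.ValiantsHypothesis.Theorems.LacunarySymmetroidMatrixDescartes.Census.RealExp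

open Finset Filter Topology
open scoped BigOperators

section EventualSigns

/-- A positive continuous prefactor times a positive power of `εE` is eventually positive as
`ε → 0⁺`. [folklore] -/
theorem eventually_nhdsGT_pow_mul_pos {g : ℝ → ℝ} (hg : Continuous g) (h0 : 0 < g 0) {E : ℝ}
    (hE : 0 < E) (k : ℕ) : ∀ᶠ ε in 𝓝[>] (0 : ℝ), 0 < (ε * E) ^ k * g ε := by
  have h1 : ∀ᶠ ε in 𝓝 (0 : ℝ), 0 < g ε := hg.continuousAt.eventually (lt_mem_nhds h0)
  have h2 : ∀ᶠ ε in 𝓝[>] (0 : ℝ), 0 < ε := eventually_mem_nhdsWithin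
  filter_upwards [h1.filter_mono nhdsWithin_le_nhds, h2] with ε h1 h2
  exact mul_pos (pow_pos (mul_pos h2 hE) k) h1

/-- First-order sign of `(εE)a + (εE)²b + (εE)³c` at `0⁺` (`a ≠ 0`). [folklore] -/
theorem cubic_mul_pos_of_first {a b c E : ℝ} (hE : 0 < E) (ha : a ≠ 0) :
    ∀ᶠ ε in 𝓝[>] (0 : ℝ), 0 < a * ((ε * E) * a + (ε * E) ^ 2 * b + (ε * E) ^ 3 * c) := by
  have h := eventually_nhdsGT_pow_mul_pos
    (g := fun ε => a * a + (ε * E) * (a * b) + (ε * E) ^ 2 * (a * c))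
    (by fun_prop) (by simpa using mul_self_pos.mpr ha) hE 1
  refine h.mono fun ε hε => ?_
  have : (ε * E) ^ 1 * (a * a + (ε * E) * (a * b) + (ε * E) ^ 2 * (a * c)) =
      a * ((ε * E) * a + (ε * E) ^ 2 * b + (ε * E) ^ 3 * c) := by ring
  rw [this] at hε; exact hε

/-- Second-order sign of `(εE)a + (εE)²b + (εE)³c` at `0⁺` (`a = 0 ≠ b`). [folklore] -/
theorem cubic_mul_pos_of_second {a b c E : ℝ} (hE : 0 < E) (ha : a = 0) (hb : b ≠ 0) :
    ∀ᶠ ε in 𝓝[>] (0 : ℝ), 0 < b * ((ε * E) * a + (ε * E) ^ 2 * b + (ε * E) ^ 3 * c) := by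
  have h := eventually_nhdsGT_pow_mul_pos (g := fun ε => b * b + (ε * E) * (b * c))
    (by fun_prop) (by simpa using mul_self_pos.mpr hb) hE 2
  refine h.mono fun ε hε => ?_
  have : (ε * E) ^ 2 * (b * b + (ε * E) * (b * c)) =
      b * ((ε * E) * a + (ε * E) ^ 2 * b + (ε * E) ^ 3 * c) := by rw [ha]; ring
  rw [this] at hε; exact hε

/-- Third-order sign of `(εE)a + (εE)²b + (εE)³c` at `0⁺` (`a = b = 0 ≠ c`). [folklore] -/
theorem cubic_mul_pos_of_third {a b c E : ℝ} (hE : 0 < E) (ha : a = 0) (hb : b = 0) (hc : c ≠ 0) :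
    ∀ᶠ ε in 𝓝[>] (0 : ℝ), 0 < c * ((ε * E) * a + (ε * E) ^ 2 * b + (ε * E) ^ 3 * c) := by
  have h := eventually_nhdsGT_pow_mul_pos (g := fun _ => c * c)
    (by fun_prop) (by simpa using mul_self_pos.mpr hc) hE 3
  refine h.mono fun ε hε => ?_
  have : (ε * E) ^ 3 * (c * c) =
      c * ((ε * E) * a + (ε * E) ^ 2 * b + (ε * E) ^ 3 * c) := by rw [ha, hb]; ring
  rw [this] at hε; exact hε

/-- A cubic in `εE` with non-zero top coefficient is eventually non-zero at `0⁺`. [folklore] -/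
theorem cubic_eventually_ne_zero {a b c E : ℝ} (hE : 0 < E) (hc : c ≠ 0) :
    ∀ᶠ ε in 𝓝[>] (0 : ℝ), (ε * E) * a + (ε * E) ^ 2 * b + (ε * E) ^ 3 * c ≠ 0 := by
  by_cases ha : a = 0
  · by_cases hb : b = 0
    · exact (cubic_mul_pos_of_third hE ha hb hc).mono fun ε h h0 => by
        rw [h0, mul_zero] at h; exact lt_irrefl _ h
    · exact (cubic_mul_pos_of_second hE ha hb).mono fun ε h h0 => by
        rw [h0, mul_zero] at h; exact lt_irrefl _ h
  · exact (cubic_mul_pos_of_first hE ha).mono fun ε h h0 => by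
      rw [h0, mul_zero] at h; exact lt_irrefl _ h

/-- **The eventual sign at `0⁺` is the sign of the first non-zero coefficient.** [folklore] -/
theorem cubic_eventually_sign {a b c E ℓ : ℝ} (hE : 0 < E)
    (hℓ : (a ≠ 0 ∧ ℓ = a) ∨ (a = 0 ∧ b ≠ 0 ∧ ℓ = b) ∨ (a = 0 ∧ b = 0 ∧ c ≠ 0 ∧ ℓ = c)) :
    (ℓ < 0 → ∀ᶠ ε in 𝓝[>] (0 : ℝ), (ε * E) * a + (ε * E) ^ 2 * b + (ε * E) ^ 3 * c < 0) ∧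
    (0 < ℓ → ∀ᶠ ε in 𝓝[>] (0 : ℝ), 0 < (ε * E) * a + (ε * E) ^ 2 * b + (ε * E) ^ 3 * c) := by
  have key : ∀ᶠ ε in 𝓝[>] (0 : ℝ), 0 < ℓ * ((ε * E) * a + (ε * E) ^ 2 * b + (ε * E) ^ 3 * c) := by
    rcases hℓ with ⟨ha, rfl⟩ | ⟨ha, hb, rfl⟩ | ⟨ha, hb, hc, rfl⟩
    · exact cubic_mul_pos_of_first hE ha
    · exact cubic_mul_pos_of_second hE ha hb
    · exact cubic_mul_pos_of_third hE ha hb hc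
  exact ⟨fun hl => key.mono fun ε h => neg_of_mul_pos_right h hl.le,
    fun hl => key.mono fun ε h => pos_of_mul_pos_right h hl.le⟩

/-- Two distinct members give cardinality at least two. [folklore] -/
theorem two_le_card_of_mem_of_mem {α : Type*} [DecidableEq α] {s : Finset α} {w₁ w₂ : α}
    (hne : w₁ ≠ w₂) (h₁ : w₁ ∈ s) (h₂ : w₂ ∈ s) : 2 ≤ s.card := by
  rw [← Finset.card_pair hne]
  exact Finset.card_le_card (fun x hx => by
    rcases Finset.mem_insert.mp hx with rfl | hx
    · exact h₁
    · rw [Finset.mem_singleton] at hx; rw [hx]; exact h₂)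

open Classical in
/-- **Balance of the four-member family.**  Members are indexed by `(V, s) ∈ Bool × Bool`
(`V`: which letter, `s`: its sign); the member functions are
`(εE)·a_V + (εE)²·b_V + (εE)³·c_V` for `s = true` and `−(εE)·a_V + (εE)²·b_V − (εE)³·c_V` for
`s = false` (odd orders flip with the sign of the letter, the even order does not).  In each of the
three cases — both first-order coefficients non-zero; first order absent and the two second-order
coefficients of opposite signs; only third order present and non-zero — at least half of the four
members are eventually negative at `0⁺` and at least half eventually positive. [folklore] -/
theorem balance_four (a b c : Bool → ℝ) {E : ℝ} (hE : 0 < E) (f : Bool × Bool → ℝ → ℝ)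
    (hf : ∀ V ε, f (V, true) ε = (ε * E) * a V + (ε * E) ^ 2 * b V + (ε * E) ^ 3 * c V)
    (hf' : ∀ V ε, f (V, false) ε = (ε * E) * (-a V) + (ε * E) ^ 2 * b V + (ε * E) ^ 3 * (-c V))
    (hcase : (a true ≠ 0 ∧ a false ≠ 0) ∨ (a true = 0 ∧ a false = 0 ∧ b true * b false < 0) ∨
      (a true = 0 ∧ a false = 0 ∧ b true = 0 ∧ b false = 0 ∧ c true ≠ 0 ∧ c false ≠ 0)) :
    Fintype.card (Bool × Bool) ≤
        2 * (univ.filter (fun w => ∀ᶠ ε in 𝓝[>] (0 : ℝ), f w ε < 0)).card ∧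
      Fintype.card (Bool × Bool) ≤
        2 * (univ.filter (fun w => ∀ᶠ ε in 𝓝[>] (0 : ℝ), 0 < f w ε)).card := by
  set Neg := univ.filter (fun w : Bool × Bool => ∀ᶠ ε in 𝓝[>] (0 : ℝ), f w ε < 0) with hNeg
  set Pos := univ.filter (fun w : Bool × Bool => ∀ᶠ ε in 𝓝[>] (0 : ℝ), 0 < f w ε) with hPos
  have hcard : Fintype.card (Bool × Bool) = 4 := by simp
  rw [hcard]
  -- membership criteria from the leading coefficient
  have memT : ∀ V ℓ, ((a V ≠ 0 ∧ ℓ = a V) ∨ (a V = 0 ∧ b V ≠ 0 ∧ ℓ = b V) ∨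
      (a V = 0 ∧ b V = 0 ∧ c V ≠ 0 ∧ ℓ = c V)) →
      (ℓ < 0 → (V, true) ∈ Neg) ∧ (0 < ℓ → (V, true) ∈ Pos) := by
    intro V ℓ hℓ
    have h := cubic_eventually_sign hE hℓ
    refine ⟨fun hl => ?_, fun hl => ?_⟩
    · rw [hNeg, Finset.mem_filter]
      exact ⟨mem_univ _, (h.1 hl).mono fun ε hε => by rw [hf]; exact hε⟩
    · rw [hPos, Finset.mem_filter]
      exact ⟨mem_univ _, (h.2 hl).mono fun ε hε => by rw [hf]; exact hε⟩
  have memF : ∀ V ℓ, ((-a V ≠ 0 ∧ ℓ = -a V) ∨ (-a V = 0 ∧ b V ≠ 0 ∧ ℓ = b V) ∨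
      (-a V = 0 ∧ b V = 0 ∧ -c V ≠ 0 ∧ ℓ = -c V)) →
      (ℓ < 0 → (V, false) ∈ Neg) ∧ (0 < ℓ → (V, false) ∈ Pos) := by
    intro V ℓ hℓ
    have h := cubic_eventually_sign hE hℓ
    refine ⟨fun hl => ?_, fun hl => ?_⟩
    · rw [hNeg, Finset.mem_filter]
      exact ⟨mem_univ _, (h.1 hl).mono fun ε hε => by rw [hf']; exact hε⟩
    · rw [hPos, Finset.mem_filter]
      exact ⟨mem_univ _, (h.2 hl).mono fun ε hε => by rw [hf']; exact hε⟩
  -- odd case: each `V` contributes one member of each sign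
  have odd : (∀ V, ∃ ℓ, ℓ ≠ 0 ∧ ((a V ≠ 0 ∧ ℓ = a V) ∨ (a V = 0 ∧ b V = 0 ∧ c V ≠ 0 ∧ ℓ = c V))) →
      4 ≤ 2 * Neg.card ∧ 4 ≤ 2 * Pos.card := by
    intro hodd
    have hV : ∀ V, ((V, true) ∈ Neg ∧ (V, false) ∈ Pos) ∨ ((V, true) ∈ Pos ∧ (V, false) ∈ Neg) := by
      intro V
      obtain ⟨ℓ, hℓ0, hℓ⟩ := hodd V
      have hT := memT V ℓ (by
        rcases hℓ with h | ⟨h1, h2, h3, h4⟩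
        · exact Or.inl h
        · exact Or.inr (Or.inr ⟨h1, h2, h3, h4⟩))
      have hF := memF V (-ℓ) (by
        rcases hℓ with ⟨h1, h2⟩ | ⟨h1, h2, h3, h4⟩
        · exact Or.inl ⟨neg_ne_zero.mpr h1, by rw [h2]⟩
        · exact Or.inr (Or.inr ⟨neg_eq_zero.mpr h1, h2, neg_ne_zero.mpr h3, by rw [h4]⟩))
      rcases lt_or_gt_of_ne hℓ0 with hl | hl
      · exact Or.inl ⟨hT.1 hl, hF.2 (neg_pos.mpr hl)⟩
      · exact Or.inr ⟨hT.2 hl, hF.1 (neg_neg_of_pos hl)⟩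
    have ht := hV true
    have hf0 := hV false
    constructor
    · have : 2 ≤ Neg.card := by
        rcases ht with ⟨h1, -⟩ | ⟨-, h1⟩ <;> rcases hf0 with ⟨h2, -⟩ | ⟨-, h2⟩
        · exact two_le_card_of_mem_of_mem (by simp) h1 h2
        · exact two_le_card_of_mem_of_mem (by simp) h1 h2
        · exact two_le_card_of_mem_of_mem (by simp) h1 h2
        · exact two_le_card_of_mem_of_mem (by simp) h1 h2
      omega
    · have : 2 ≤ Pos.card := by
        rcases ht with ⟨-, h1⟩ | ⟨h1, -⟩ <;> rcases hf0 with ⟨-, h2⟩ | ⟨h2, -⟩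
        · exact two_le_card_of_mem_of_mem (by simp) h1 h2
        · exact two_le_card_of_mem_of_mem (by simp) h1 h2
        · exact two_le_card_of_mem_of_mem (by simp) h1 h2
        · exact two_le_card_of_mem_of_mem (by simp) h1 h2
      omega
  rcases hcase with ⟨h1, h2⟩ | ⟨h1, h2, h3⟩ | ⟨h1, h2, h3, h4, h5, h6⟩
  · exact odd fun V => by
      cases V
      · exact ⟨a false, h2, Or.inl ⟨h2, rfl⟩⟩
      · exact ⟨a true, h1, Or.inl ⟨h1, rfl⟩⟩
  · -- even case: the two letters have opposite second-order signs
    have hbt : b true ≠ 0 := fun h => by rw [h, zero_mul] at h3; exact lt_irrefl _ h3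
    have hbf : b false ≠ 0 := fun h => by rw [h, mul_zero] at h3; exact lt_irrefl _ h3
    have hT := fun V (hb : b V ≠ 0) (ha : a V = 0) => memT V (b V) (Or.inr (Or.inl ⟨ha, hb, rfl⟩))
    have hF := fun V (hb : b V ≠ 0) (ha : a V = 0) =>
      memF V (b V) (Or.inr (Or.inl ⟨neg_eq_zero.mpr ha, hb, rfl⟩))
    rcases lt_or_gt_of_ne hbt with hl | hl
    · have hl' : 0 < b false := by nlinarith
      constructor
      · have := two_le_card_of_mem_of_mem (by simp) ((hT true hbt h1).1 hl) ((hF true hbt h1).1 hl)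
        omega
      · have := two_le_card_of_mem_of_mem (by simp) ((hT false hbf h2).2 hl')
          ((hF false hbf h2).2 hl')
        omega
    · have hl' : b false < 0 := by nlinarith
      constructor
      · have := two_le_card_of_mem_of_mem (by simp) ((hT false hbf h2).1 hl')
          ((hF false hbf h2).1 hl')
        omega
      · have := two_le_card_of_mem_of_mem (by simp) ((hT true hbt h1).2 hl) ((hF true hbt h1).2 hl)
        omega
  · exact odd fun V => by
      cases V
      · exact ⟨c false, h6, Or.inr ⟨h2, h4, h6, rfl⟩⟩
      · exact ⟨c true, h5, Or.inr ⟨h1, h3, h5, rfl⟩⟩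

end EventualSigns

end Summit.ValiantsHypothesis.ValiantsHypothesis.Theorems.LacunarySymmetroidMatrixDescartes.Census.RealExp
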